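import Literature.MathematicalPhysics.QuantumFieldTheory.Balaban1983to89.B9Thm33GDecayOfCoerciveZd
import Literature.MathematicalPhysics.QuantumFieldTheory.Balaban1983to89.B9Eq325QGGQDecayPlaqClosedZd

/-!
# `Balaban1983to89.B9Eq326DeltaAMajorantAssemblyZd` — [Balaban1985BackgroundPropagators] (3.26)–(3.27) p. 395, Thm 3.3 p. 399, Thm 3.11 p. 416: THE ALMOST-LOCAL
# MAJORANT OF THE FOUR-LETTER `Δ_a(U₀) = D*D + Δ′ + DRD* + Q*aQ` ASSEMBLED FROM PER-LETTER BOUNDS, AND STATION 5 CLOSED MODULO THEM: finite-range bounds for the three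
# local letters `D*D`, `Δ′`, `Q*aQ` on Hermitian single-bond bumps (displayed — elementary kinematics, not typed here) + the exponential decay of the `DRD*` letter
# (this seat's `B9Eq326DRDsKernelDecayZd`, displayed here in the letter record's currency) ⟹ the rows ∕ columns of this seat's station-5 reduction
# `B9Thm33GDecayOfCoerciveZd.fnorm_gopZdH_bump_le_exp_of_coercive` are small for a small conjugation rate ⟹ `|(G_𝔤(U₀)δ_{b′}w)(b)|_τ ≤ C·e^{−κ|b−b′|_∞}·|w|_τ`
# with `(C, κ)` depending only on the displayed numbers `(c, B_loc, r, C_D, κ_D, d)`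

statement-level skeleton of published theorems with citation tags; proofs where landed; nothing here is a claim about the
Yang–Mills mass gap

`[Balaban1985BackgroundPropagators]` ("B9", CMP **99** (1985) 389–434): (3.26)–(3.27) p. 395, Thm 3.3 p. 399 («(3.42)–(3.47) with G′ replaced by G»), (3.63)–(3.68)
pp. 404–405, Thm 3.11 p. 416; [Balaban1984PropagatorsII] p. 226; [Balaban1988RG2Cluster] (2.5)–(2.7) pp. 12–13 (random-walk ∕ Combes–Thomas shape).  HERE: bookkeeping —
the window `ϱ(κ′) < c` for the sum of a finite-range majorant and an exponentially decaying one over the bonds of a finite `Ω₀`.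

CITATION HEADER (lean-in-tree rule).  Cell `pub-ymgap` (YM Track A, HUMAN RULING D-0062 ∕ D-0149 width push), DAG node N06 = [B9], width seat
`pub-ymgap-dag-n06-w2` (g4), CLAIM-11.  Inputs BY NAME: this seat's `B9Thm33GDecayOfCoerciveZd.fnorm_gopZdH_bump_le_exp_of_coercive` (station 5 reduction),
`B9Eq349KernelCompositionZd.rowsum_expMajorant_le_linear`, `B9Thm31GpDecayOfCoerciveZd.card_filter_linfDist_le`, `B9Eq325QGGQDecayPlaqClosedZd.{Kd_le_of_mem,
exists_small_rate}`, `B9Eq342CombesThomasFormZd.{fnorm, fnorm_add_le}`; dag-n06-w4's `B9Eq327GreenZdHerm.{gopZdH, RegularAtH, domSubH}`, `B9Eq327GreenZd.bondPair`,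
`B9SupplySockB9P3ZdLetters.{OpsZd, deltaAOf}`, `B8Eq155JBound.Jcur`, `B7Prop5Flat.bump`.  Nothing restated.

WHAT IS PROVED (kernel, 0 sorry, 0 def).
* §1 counting over bonds: `card_filter_fst_eq_le` (at most `d` bonds over a site), `card_filter_bond_near_le` (at most `(2r+1)ᵈ·d` bonds of `S` within `r` of a site).
* §2 the combined majorant `A(b,b′) = B_loc·𝟙[|b−b′|_∞ ≤ r] + C_D·e^{−κ_D|b−b′|_∞}`: `rowsum_loc_le`, `rowsum_combined_le` (rows `≤ κ′·G` for `κ′ ≤ κ_D∕4`, an explicit `G`),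
  ★ `exists_rate_rows_lt` (for every `c > 0` a rate `κ′ > 0` and `ϱ < c` bounding all rows and columns).
* §3 `fnorm_deltaAOf_bump_le_of_letters` — the four per-letter bounds give the block bound of `Δ_a` by `A(b,b′)`; `indicator_range_mono`,
  `fnorm_deltaAOf_bump_le_of_letters'` (three ranges `r_J, r_{Δ′}, r_Q ≤ r` — dag-n06-b's `B9Eq326LocalLettersBumpBoundsZd` supplies `r_J = r_{Δ′} = 1`, `r_Q = 2Lᵐ`).
* §4 ★★★ `exists_fnorm_gopZdH_bump_le_exp_of_letters` — STATION 5 CLOSED MODULO THE LETTER BOUNDS: for displayed numbers `c > 0`, `B_loc ≥ 0`, `r`, `C_D ≥ 0`, `κ_D > 0`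
  there are `C > 0`, `κ > 0` such that for EVERY letter record `o`, finite `Ω₀`, background `U₀` with `RegularAtH`, coercivity `c·‖A‖²_τ ≤ ⟨A, Δ_a(U₀)A⟩_τ` on `E_𝔤(Ω₀)`,
  local letters bounded by `B_•·𝟙[|b−b′|_∞ ≤ r]` (`B_J + B_{Δ′} + B_Q ≤ B_loc`) and `DRD*` letter bounded by `C_D e^{−κ_D|b−b′|_∞}` on Hermitian bumps of the bonds of `Ω₀`:
  `|(G_𝔤(U₀)δ_{b′}w)(b)|_τ ≤ C·e^{−κ|b−b′|_∞}·|w|_τ`.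

HONEST SCOPE.  Count-neutral helper; the three local-letter bounds and the `DRD*` decay in the record's currency are DISPLAYED (the latter is this seat's
`B9Eq326DRDsKernelDecayZd` for the `opsLandau` letter at finite `Ω₀`, up to the identification of the level sets); crude constants; N05 ∕ N06 NOT discharged;
K1⁹ `stmt-QuantumFields-27364` NOT closed; one finite `𝕋⁴` programme at fixed `ε`, Bałaban as printed; R4 closes only the conditional finite-`𝕋⁴` rung
`BalabanLadder.UV` — nothing continuum ∕ ℝ⁴ ∕ OS ∕ mass gap ∕ Clay.  Unit `pub-ymgap-dag-n06-w2` (g4), 2026-08-28.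
-/

noncomputable section

open scoped BigOperators Nat

namespace Literature.MathematicalPhysics.QuantumFieldTheory.Balaban1983to89.B9Eq326DeltaAMajorantAssemblyZd

open B7Prop5Flat (bump)
open B8Ineq132 (BondTouches)
open B8Eq155JBound (Jcur)
open B9SupplySockB9P3ZdLetters (OpsZd deltaAOf)
open B9Eq327GreenZd (bondPair setOf_bondTouches_finite)
open B9Eq327GreenZdHerm (domSubH RegularAtH gopZdH)
open B9Eq342CombesThomasFormZd (fnorm fnorm_nonneg fnorm_add_le)
open B9Thm31GpDecayOfCoerciveZd (card_filter_linfDist_le)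
open B9Eq349KernelCompositionZd (rowsum_expMajorant_le_linear sum_exp_neg_mul_linfDist_le)
open B9Eq325QGGQDecayPlaqClosedZd (Kd_le_of_mem exists_small_rate)
open B9Thm33GDecayOfCoerciveZd (fnorm_gopZdH_bump_le_exp_of_coercive)
open LatticeNorms (linfDist)

export B7Prop1Explicit (Site)

variable {d : ℕ}

/-! ## §1  Counting over bonds -/

section Counting

/-- at most `d` bonds of `S` sit over a site. [cite: Balaban1985RegularSpaces, p.77 (bond convention; bookkeeping)] -/
theorem card_filter_fst_eq_le (S : Finset (Site d × Fin d)) (p : Site d) : (S.filter (fun b => b.1 = p)).card ≤ d := by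
  classical
  have h := Finset.card_le_card_of_injOn (s := S.filter (fun b => b.1 = p)) (t := (Finset.univ : Finset (Fin d))) Prod.snd
    (fun b _ => Finset.mem_coe.mpr (Finset.mem_univ _)) (by
      intro b hb b' hb' h
      rw [Finset.mem_coe, Finset.mem_filter] at hb hb'
      exact Prod.ext (hb.2.trans hb'.2.symm) h)
  rwa [Finset.card_univ, Fintype.card_fin] at h

/-- at most `(2r+1)ᵈ·d` bonds of `S` start within `ℓ^∞`-distance `r` of a site `x`. [cite: Balaban1985BackgroundPropagators, (3.107)–(3.108) pp.415–416 (bookkeeping)] -/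
theorem card_filter_bond_near_le (S : Finset (Site d × Fin d)) (x : Site d) (r : ℕ) :
    (S.filter (fun b => linfDist x b.1 ≤ r)).card ≤ (2 * r + 1) ^ d * d := by
  classical
  have hsub : S.filter (fun b => linfDist x b.1 ≤ r) ⊆ ((S.image Prod.fst).filter (fun z => linfDist x z ≤ r)) ×ˢ (Finset.univ : Finset (Fin d)) := by
    intro b hb
    rw [Finset.mem_filter] at hb
    rw [Finset.mem_product, Finset.mem_filter]
    exact ⟨⟨Finset.mem_image_of_mem _ hb.1, hb.2⟩, Finset.mem_univ _⟩
  refine (Finset.card_le_card hsub).trans ?_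
  rw [Finset.card_product, Finset.card_univ, Fintype.card_fin]
  exact Nat.mul_le_mul_right d (card_filter_linfDist_le (S.image Prod.fst) x r)

/-- `e^t − 1 ≤ t·e^t` (convexity: `e^{−t} ≥ 1 − t`; private copy of `AreaLaw.exp_sub_one_le_mul_exp` to keep the import closure small). [folklore] -/
private theorem exp_sub_one_le_mul_exp' (t : ℝ) : Real.exp t - 1 ≤ t * Real.exp t := by
  have h := Real.add_one_le_exp (-t)
  have hpos := Real.exp_pos t
  have hprod : Real.exp (-t) * Real.exp t = 1 := by rw [← Real.exp_add, neg_add_cancel, Real.exp_zero]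
  nlinarith [mul_le_mul_of_nonneg_right h hpos.le]

end Counting

/-! ## §2  The combined majorant and its window -/

section Window

variable (S : Finset (Site d × Fin d)) (Bloc : ℝ) (r : ℕ) (CD κD : ℝ)

/-- rows of the finite-range part: `Σ_{b′∈S} B_loc·𝟙[|b−b′|_∞ ≤ r]·(e^{κ′|b−b′|_∞} − 1) ≤ B_loc·(2r+1)ᵈ·d·(e^{κ′r} − 1)` (`B_loc, κ′ ≥ 0`).
[cite: Balaban1985BackgroundPropagators, (3.42) p.397, (3.107)–(3.108) pp.415–416 (bookkeeping)] -/
theorem rowsum_loc_le (hB : 0 ≤ Bloc) {κ' : ℝ} (hκ' : 0 ≤ κ') (b : Site d × Fin d) :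
    ∑ b' ∈ S, Bloc * (if linfDist b.1 b'.1 ≤ r then (1 : ℝ) else 0) * (Real.exp (κ' * (linfDist b.1 b'.1 : ℝ)) - 1) ≤
      Bloc * (((2 * r + 1) ^ d * d : ℕ) : ℝ) * (Real.exp (κ' * r) - 1) := by
  classical
  have hterm : ∀ b' ∈ S, Bloc * (if linfDist b.1 b'.1 ≤ r then (1 : ℝ) else 0) * (Real.exp (κ' * (linfDist b.1 b'.1 : ℝ)) - 1) ≤
      if linfDist b.1 b'.1 ≤ r then Bloc * (Real.exp (κ' * r) - 1) else 0 := by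
    intro b' _
    split_ifs with h
    · rw [mul_one]
      refine mul_le_mul_of_nonneg_left (sub_le_sub_right (Real.exp_le_exp.mpr ?_) 1) hB
      exact mul_le_mul_of_nonneg_left (by exact_mod_cast h) hκ'
    · rw [mul_zero, zero_mul]
  refine (Finset.sum_le_sum hterm).trans ?_
  rw [← Finset.sum_filter, Finset.sum_const, nsmul_eq_mul]
  have hcard : ((S.filter (fun b' : Site d × Fin d => linfDist b.1 b'.1 ≤ r)).card : ℝ) ≤ (((2 * r + 1) ^ d * d : ℕ) : ℝ) := by
    exact_mod_cast card_filter_bond_near_le S b.1 r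
  have hE : 0 ≤ Bloc * (Real.exp (κ' * r) - 1) := mul_nonneg hB (by
    have : 1 ≤ Real.exp (κ' * r) := Real.one_le_exp_iff.mpr (by positivity)
    linarith)
  calc ((S.filter (fun b' : Site d × Fin d => linfDist b.1 b'.1 ≤ r)).card : ℝ) * (Bloc * (Real.exp (κ' * r) - 1))
      ≤ (((2 * r + 1) ^ d * d : ℕ) : ℝ) * (Bloc * (Real.exp (κ' * r) - 1)) := mul_le_mul_of_nonneg_right hcard hE
    _ = _ := by ring

/-- ★ **ROWS OF THE COMBINED MAJORANT ARE `≤ κ′·G` FOR `0 ≤ κ′ ≤ κ_D∕4`**, `A(b,b′) = B_loc·𝟙[|b−b′|_∞ ≤ r] + C_D·e^{−κ_D|b−b′|_∞}`, with the explicit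
`G = B_loc·(2r+1)ᵈd·r·e^{κ_D r∕4} + (4∕κ_D)·C_D·d·K*`, `K* = 3ᵈ·d!·(8∕κ_D)ᵈ·e^{κ_D∕4}∕(1 − e^{−κ_D∕8})`.
[cite: Balaban1985BackgroundPropagators, (3.42) p.397, (3.63)–(3.68) pp.404–405, (3.107)–(3.108) pp.415–416] -/
theorem rowsum_combined_le (hB : 0 ≤ Bloc) (hCD : 0 ≤ CD) (hκD : 0 < κD) {κ' : ℝ} (hκ' : 0 ≤ κ') (hκ'le : κ' ≤ κD / 4) (b : Site d × Fin d) :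
    ∑ b' ∈ S, (Bloc * (if linfDist b.1 b'.1 ≤ r then (1 : ℝ) else 0) + CD * Real.exp (-(κD * (linfDist b.1 b'.1 : ℝ)))) *
        (Real.exp (κ' * (linfDist b.1 b'.1 : ℝ)) - 1) ≤
      κ' * (Bloc * (((2 * r + 1) ^ d * d : ℕ) : ℝ) * (r * Real.exp (κD / 4 * r)) +
        2 / (κD / 2) * (CD * ((d : ℝ) *
          ((3 : ℝ) ^ d * (d ! : ℝ) * (2 / (2 * κD / 8)) ^ d * Real.exp (2 * κD / 8) / (1 - Real.exp (-(2 * κD / 16))))))) := by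
  have hsplit : ∀ b' ∈ S, (Bloc * (if linfDist b.1 b'.1 ≤ r then (1 : ℝ) else 0) + CD * Real.exp (-(κD * (linfDist b.1 b'.1 : ℝ)))) *
        (Real.exp (κ' * (linfDist b.1 b'.1 : ℝ)) - 1) =
      Bloc * (if linfDist b.1 b'.1 ≤ r then (1 : ℝ) else 0) * (Real.exp (κ' * (linfDist b.1 b'.1 : ℝ)) - 1) +
        CD * Real.exp (-(κD * (linfDist b.1 b'.1 : ℝ))) * (Real.exp (κ' * (linfDist b.1 b'.1 : ℝ)) - 1) := fun b' _ => by ring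
  rw [Finset.sum_congr rfl hsplit, Finset.sum_add_distrib, mul_add]
  refine add_le_add ?_ ?_
  · -- the finite-range part
    refine (rowsum_loc_le S Bloc r hB hκ' b).trans ?_
    have hr0 : (0 : ℝ) ≤ r := Nat.cast_nonneg r
    have h1 : Real.exp (κ' * r) - 1 ≤ κ' * r * Real.exp (κ' * r) := exp_sub_one_le_mul_exp' _
    have h2 : Real.exp (κ' * r) ≤ Real.exp (κD / 4 * r) := Real.exp_le_exp.mpr (mul_le_mul_of_nonneg_right hκ'le hr0)
    have hN : (0 : ℝ) ≤ (((2 * r + 1) ^ d * d : ℕ) : ℝ) := Nat.cast_nonneg _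
    calc Bloc * (((2 * r + 1) ^ d * d : ℕ) : ℝ) * (Real.exp (κ' * r) - 1)
        ≤ Bloc * (((2 * r + 1) ^ d * d : ℕ) : ℝ) * (κ' * r * Real.exp (κD / 4 * r)) :=
          mul_le_mul_of_nonneg_left (h1.trans (mul_le_mul_of_nonneg_left h2 (by positivity))) (mul_nonneg hB hN)
      _ = κ' * (Bloc * (((2 * r + 1) ^ d * d : ℕ) : ℝ) * (r * Real.exp (κD / 4 * r))) := by ring
  · -- the exponential part (this seat's `rowsum_expMajorant_le_linear` at `loc = Prod.fst`, fibres `≤ d`)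
    have h := rowsum_expMajorant_le_linear (d := d) S Prod.fst (mF := d) (card_filter_fst_eq_le S) hκ' (by linarith : κ' < κD) hCD
      (fun b b' => CD * Real.exp (-(κD * (linfDist b.1 b'.1 : ℝ)))) (fun _ _ => le_rfl) b
    refine h.trans ((mul_assoc _ _ _).le.trans (mul_le_mul_of_nonneg_left ?_ hκ'))
    have hμ1 : 2 * κD / 8 ≤ (κD - κ') / 2 := by linarith
    have hμ2 : (κD - κ') / 2 ≤ 2 * κD / 4 := by linarith
    have hKd := Kd_le_of_mem (d := d) (by linarith : 0 < 2 * κD) hμ1 hμ2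
    have hKμ0 : 0 ≤ (3 : ℝ) ^ d * (d ! : ℝ) * (2 / ((κD - κ') / 2)) ^ d * Real.exp ((κD - κ') / 2 / 2) / (1 - Real.exp (-((κD - κ') / 2 / 2))) := by
      have h0 := sum_exp_neg_mul_linfDist_le (d := d) (μ := (κD - κ') / 2) (by linarith) ∅ (0 : Site d)
      rwa [Finset.sum_empty] at h0
    have hfrac : 2 / (κD - κ') ≤ 2 / (κD / 2) := div_le_div_of_nonneg_left (by norm_num) (by positivity) (by linarith)
    exact mul_le_mul hfrac (mul_le_mul_of_nonneg_left (mul_le_mul_of_nonneg_left hKd (Nat.cast_nonneg _)) hCD)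
      (mul_nonneg hCD (mul_nonneg (Nat.cast_nonneg _) hKμ0)) (by positivity)

/-- ★ **THE WINDOW**: for every `c > 0` there are a conjugation rate `κ′ > 0` and `ϱ < c` bounding ALL rows and columns of the combined majorant over ANY finite
bond set `S`. [cite: Balaban1985BackgroundPropagators, (3.42) p.397, Thm 3.3 p.399, (3.63)–(3.68) pp.404–405] -/
theorem exists_rate_rows_lt (hB : 0 ≤ Bloc) (hCD : 0 ≤ CD) (hκD : 0 < κD) {c : ℝ} (hc : 0 < c) :
    ∃ κ' : ℝ, 0 < κ' ∧ ∃ ϱ : ℝ, ϱ < c ∧ ∀ (S : Finset (Site d × Fin d)),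
      (∀ b : Site d × Fin d, ∑ b' ∈ S, (Bloc * (if linfDist b.1 b'.1 ≤ r then (1 : ℝ) else 0) + CD * Real.exp (-(κD * (linfDist b.1 b'.1 : ℝ)))) *
          (Real.exp (κ' * (linfDist b.1 b'.1 : ℝ)) - 1) ≤ ϱ) ∧
      (∀ b' : Site d × Fin d, ∑ b ∈ S, (Bloc * (if linfDist b.1 b'.1 ≤ r then (1 : ℝ) else 0) + CD * Real.exp (-(κD * (linfDist b.1 b'.1 : ℝ)))) *
          (Real.exp (κ' * (linfDist b.1 b'.1 : ℝ)) - 1) ≤ ϱ) := by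
  have hden : 0 < 1 - Real.exp (-(2 * κD / 16)) := by
    have : Real.exp (-(2 * κD / 16)) < 1 := Real.exp_lt_one_iff.mpr (by linarith)
    linarith
  set G : ℝ := Bloc * (((2 * r + 1) ^ d * d : ℕ) : ℝ) * (r * Real.exp (κD / 4 * r)) +
    2 / (κD / 2) * (CD * ((d : ℝ) * ((3 : ℝ) ^ d * (d ! : ℝ) * (2 / (2 * κD / 8)) ^ d * Real.exp (2 * κD / 8) / (1 - Real.exp (-(2 * κD / 16)))))) with hG
  have hG0 : 0 ≤ G := by rw [hG]; positivity
  obtain ⟨κ', hκ'0, hκ'le, hκ'G⟩ := exists_small_rate hc hκD hG0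
  refine ⟨κ', hκ'0, κ' * G, by linarith, fun S => ⟨fun b => ?_, fun b' => ?_⟩⟩
  · exact (rowsum_combined_le S Bloc r CD κD hB hCD hκD hκ'0.le hκ'le b).trans (le_of_eq (by rw [hG]))
  · have hsym := rowsum_combined_le S Bloc r CD κD hB hCD hκD hκ'0.le hκ'le b'
    refine le_trans (le_of_eq (Finset.sum_congr rfl fun b _ => ?_)) (hsym.trans (le_of_eq (by rw [hG])))
    rw [LatticeNorms.linfDist_comm b.1 b'.1]

end Window

/-! ## §3  The block bound of `Δ_a` from the four letter bounds -/

section Letters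

variable {𝔸 : Type*} [CStarAlgebra 𝔸] (τ : 𝔸 →ₗ[ℂ] ℂ)

/-- **THE FOUR LETTER BOUNDS GIVE THE BLOCK BOUND OF `Δ_a = D*D + Δ′ + DRD* + Q*aQ`** on a single-bond bump. [cite: Balaban1985BackgroundPropagators, (3.26) p.395, (3.10) p.392] -/
theorem fnorm_deltaAOf_bump_le_of_letters (hτp : ∀ a : 𝔸, a ≠ 0 → 0 < (τ (star a * a)).re) (hτs : ∀ a : 𝔸, τ (star a) = starRingEnd ℂ (τ a))
    (η : ℝ) (o : OpsZd d 𝔸) (U₀ : Site d → Fin d → 𝔸ˣ) {BJ BDp BQ CD κD : ℝ} {r : ℕ} (b b' : Site d × Fin d) (w : 𝔸)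
    (hJ : fnorm τ (Jcur η U₀ (bump b'.1 b'.2 w) b.2 b.1) ≤ BJ * (if linfDist b.1 b'.1 ≤ r then (1 : ℝ) else 0) * fnorm τ w)
    (hDp : fnorm τ (o.Dp U₀ (bump b'.1 b'.2 w) b.1 b.2) ≤ BDp * (if linfDist b.1 b'.1 ≤ r then (1 : ℝ) else 0) * fnorm τ w)
    (hDRD : fnorm τ (o.DRDs U₀ (bump b'.1 b'.2 w) b.1 b.2) ≤ CD * Real.exp (-(κD * (linfDist b.1 b'.1 : ℝ))) * fnorm τ w)
    (hQQ : fnorm τ (o.QQ U₀ (bump b'.1 b'.2 w) b.1 b.2) ≤ BQ * (if linfDist b.1 b'.1 ≤ r then (1 : ℝ) else 0) * fnorm τ w) :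
    fnorm τ (deltaAOf η o U₀ (bump b'.1 b'.2 w) b.1 b.2) ≤
      ((BJ + BDp + BQ) * (if linfDist b.1 b'.1 ≤ r then (1 : ℝ) else 0) + CD * Real.exp (-(κD * (linfDist b.1 b'.1 : ℝ)))) * fnorm τ w := by
  have hΔ : deltaAOf η o U₀ (bump b'.1 b'.2 w) b.1 b.2 = Jcur η U₀ (bump b'.1 b'.2 w) b.2 b.1 + o.Dp U₀ (bump b'.1 b'.2 w) b.1 b.2 +
      o.DRDs U₀ (bump b'.1 b'.2 w) b.1 b.2 + o.QQ U₀ (bump b'.1 b'.2 w) b.1 b.2 := rfl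
  rw [hΔ]
  set x1 := Jcur η U₀ (bump b'.1 b'.2 w) b.2 b.1
  set x2 := o.Dp U₀ (bump b'.1 b'.2 w) b.1 b.2
  set x3 := o.DRDs U₀ (bump b'.1 b'.2 w) b.1 b.2
  set x4 := o.QQ U₀ (bump b'.1 b'.2 w) b.1 b.2
  have h12 := fnorm_add_le hτp hτs x1 x2
  have h123 := fnorm_add_le hτp hτs (x1 + x2) x3
  have h1234 := fnorm_add_le hτp hτs (x1 + x2 + x3) x4
  have hexp : ((BJ + BDp + BQ) * (if linfDist b.1 b'.1 ≤ r then (1 : ℝ) else 0) + CD * Real.exp (-(κD * (linfDist b.1 b'.1 : ℝ)))) * fnorm τ w =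
      BJ * (if linfDist b.1 b'.1 ≤ r then (1 : ℝ) else 0) * fnorm τ w + BDp * (if linfDist b.1 b'.1 ≤ r then (1 : ℝ) else 0) * fnorm τ w +
        CD * Real.exp (-(κD * (linfDist b.1 b'.1 : ℝ))) * fnorm τ w + BQ * (if linfDist b.1 b'.1 ≤ r then (1 : ℝ) else 0) * fnorm τ w := by ring
  rw [hexp]
  linarith

/-- indicator monotonicity in the range: `𝟙[t ≤ r′] ≤ 𝟙[t ≤ r]` for `r′ ≤ r`. [cite: Balaban1985BackgroundPropagators, (3.26) p.395 (bookkeeping)] -/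
theorem indicator_range_mono {t r' r : ℕ} (h : r' ≤ r) : (if t ≤ r' then (1 : ℝ) else 0) ≤ (if t ≤ r then (1 : ℝ) else 0) := by
  by_cases ht : t ≤ r'
  · rw [if_pos ht, if_pos (ht.trans h)]
  · rw [if_neg ht]; positivity

/-- **THE SAME WITH THREE RANGES** `r_J, r_{Δ′}, r_Q ≤ r` (dag-n06-b's letter bounds come with `r_J = r_{Δ′} = 1`, `r_Q = 2Lᵐ`).
[cite: Balaban1985BackgroundPropagators, (3.26) p.395, (3.10) p.392, (3.16) p.393] -/
theorem fnorm_deltaAOf_bump_le_of_letters' (hτp : ∀ a : 𝔸, a ≠ 0 → 0 < (τ (star a * a)).re) (hτs : ∀ a : 𝔸, τ (star a) = starRingEnd ℂ (τ a))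
    (η : ℝ) (o : OpsZd d 𝔸) (U₀ : Site d → Fin d → 𝔸ˣ) {BJ BDp BQ CD κD : ℝ} (hBJ : 0 ≤ BJ) (hBDp : 0 ≤ BDp) (hBQ : 0 ≤ BQ) {rJ rDp rQ r : ℕ}
    (hrJ : rJ ≤ r) (hrDp : rDp ≤ r) (hrQ : rQ ≤ r) (b b' : Site d × Fin d) (w : 𝔸)
    (hJ : fnorm τ (Jcur η U₀ (bump b'.1 b'.2 w) b.2 b.1) ≤ BJ * (if linfDist b.1 b'.1 ≤ rJ then (1 : ℝ) else 0) * fnorm τ w)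
    (hDp : fnorm τ (o.Dp U₀ (bump b'.1 b'.2 w) b.1 b.2) ≤ BDp * (if linfDist b.1 b'.1 ≤ rDp then (1 : ℝ) else 0) * fnorm τ w)
    (hDRD : fnorm τ (o.DRDs U₀ (bump b'.1 b'.2 w) b.1 b.2) ≤ CD * Real.exp (-(κD * (linfDist b.1 b'.1 : ℝ))) * fnorm τ w)
    (hQQ : fnorm τ (o.QQ U₀ (bump b'.1 b'.2 w) b.1 b.2) ≤ BQ * (if linfDist b.1 b'.1 ≤ rQ then (1 : ℝ) else 0) * fnorm τ w) :
    fnorm τ (deltaAOf η o U₀ (bump b'.1 b'.2 w) b.1 b.2) ≤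
      ((BJ + BDp + BQ) * (if linfDist b.1 b'.1 ≤ r then (1 : ℝ) else 0) + CD * Real.exp (-(κD * (linfDist b.1 b'.1 : ℝ)))) * fnorm τ w := by
  have hw := fnorm_nonneg τ w
  refine fnorm_deltaAOf_bump_le_of_letters τ hτp hτs η o U₀ b b' w ?_ ?_ hDRD ?_
  · exact hJ.trans (mul_le_mul_of_nonneg_right (mul_le_mul_of_nonneg_left (indicator_range_mono hrJ) hBJ) hw)
  · exact hDp.trans (mul_le_mul_of_nonneg_right (mul_le_mul_of_nonneg_left (indicator_range_mono hrDp) hBDp) hw)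
  · exact hQQ.trans (mul_le_mul_of_nonneg_right (mul_le_mul_of_nonneg_left (indicator_range_mono hrQ) hBQ) hw)

end Letters

/-! ## §4  ★★★ Station 5 closed modulo the letter bounds -/

section Station5

variable {𝔸 : Type*} [CStarAlgebra 𝔸] (τ : 𝔸 →ₗ[ℂ] ℂ)

/-- ★★★ **THE KERNEL OF `G_𝔤(U₀) = (Ω₀Δ_a(U₀)Ω₀)⁻¹` DECAYS, GIVEN A COERCIVITY CONSTANT AND THE ALMOST-LOCAL BLOCK BOUND OF `Δ_a`, WITH CONSTANTS DEPENDING ONLY ON THE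
DISPLAYED NUMBERS.**  For `c > 0`, `B_loc ≥ 0`, a range `r`, `C_D ≥ 0`, `κ_D > 0` there are `C > 0`, `κ > 0` such that: for EVERY letter record `o`, rate `η`, finite `Ω₀`,
background `U₀` with `RegularAtH`, faithful Hermitian `τ`, coercivity `c·‖A‖²_τ ≤ ⟨A, Δ_a(U₀)A⟩_τ` on `E_𝔤(Ω₀)`, and block bound
`|(Δ_a(U₀)δ_{b′}w)(b)|_τ ≤ (B_loc·𝟙[|b−b′|_∞ ≤ r] + C_D·e^{−κ_D|b−b′|_∞})·|w|_τ` on the bonds of `Ω₀` (Hermitian `w`; from the four letters by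
`fnorm_deltaAOf_bump_le_of_letters`):  `|(G_𝔤(U₀)δ_{b′}w)(b)|_τ ≤ C·e^{−κ|b−b′|_∞}·|w|_τ`.
[cite: Balaban1985BackgroundPropagators, Thm 3.3 p.399, (3.26)–(3.27) p.395, (3.63)–(3.68) pp.404–405, Thm 3.11 p.416; Balaban1984PropagatorsII, p.226; Balaban1988RG2Cluster, (2.5)–(2.7) pp.12–13] -/
theorem exists_fnorm_gopZdH_bump_le_exp_of_letters (hτp : ∀ a : 𝔸, a ≠ 0 → 0 < (τ (star a * a)).re) (hτs : ∀ a : 𝔸, τ (star a) = starRingEnd ℂ (τ a))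
    {c Bloc CD κD : ℝ} (r : ℕ) (hc : 0 < c) (hB : 0 ≤ Bloc) (hCD : 0 ≤ CD) (hκD : 0 < κD) :
    ∃ C : ℝ, 0 < C ∧ ∃ κ : ℝ, 0 < κ ∧ ∀ (η : ℝ) (o : OpsZd d 𝔸) (Ω₀ : Set (Site d)) (hΩ : Ω₀.Finite) (U₀ : Site d → Fin d → 𝔸ˣ),
      RegularAtH η o Ω₀ U₀ → (∀ A ∈ domSubH (𝔸 := 𝔸) Ω₀, c * bondPair τ A A ≤ bondPair τ A (deltaAOf η o U₀ A)) →
      (∀ b b' : Site d × Fin d, BondTouches Ω₀ b.1 b.2 → BondTouches Ω₀ b'.1 b'.2 → ∀ w : 𝔸, IsSelfAdjoint w →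
        fnorm τ (deltaAOf η o U₀ (bump b'.1 b'.2 w) b.1 b.2) ≤
          (Bloc * (if linfDist b.1 b'.1 ≤ r then (1 : ℝ) else 0) + CD * Real.exp (-(κD * (linfDist b.1 b'.1 : ℝ)))) * fnorm τ w) →
      ∀ b b' : Site d × Fin d, BondTouches Ω₀ b.1 b.2 → BondTouches Ω₀ b'.1 b'.2 → ∀ w : 𝔸, IsSelfAdjoint w →
        fnorm τ (gopZdH η o Ω₀ U₀ (bump b'.1 b'.2 w) b.1 b.2) ≤ C * Real.exp (-(κ * (linfDist b.1 b'.1 : ℝ))) * fnorm τ w := by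
  obtain ⟨κ', hκ', ϱ, hϱ, hwin⟩ := exists_rate_rows_lt Bloc r CD κD hB hCD hκD hc
  have hcϱ : 0 < c - ϱ := by linarith
  refine ⟨1 / (c - ϱ), by positivity, κ', hκ', fun η o Ω₀ hΩ U₀ hreg hco hΔ b b' hb hb' w hw => ?_⟩
  obtain ⟨hrow, hcol⟩ := hwin (setOf_bondTouches_finite hΩ).toFinset
  have key := fnorm_gopZdH_bump_le_exp_of_coercive η o U₀ τ hΩ hτp hτs hreg hκ'.le hco
    (fun e e' => Bloc * (if linfDist e.1 e'.1 ≤ r then (1 : ℝ) else 0) + CD * Real.exp (-(κD * (linfDist e.1 e'.1 : ℝ))))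
    (fun e e' => by positivity) hΔ (fun e _ => hrow e) (fun e' _ => hcol e') hϱ hb hb' hw
  refine key.trans (le_of_eq ?_)
  rw [div_eq_mul_one_div, mul_comm (Real.exp _) (1 / (c - ϱ))]

end Station5

end Literature.MathematicalPhysics.QuantumFieldTheory.Balaban1983to89.B9Eq326DeltaAMajorantAssemblyZd

end
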